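/-
Copyright: fleet lead `ym-wcr-19456-p1` (seat prover-ym-wcr-19456-p1-g0-0), route `WeakCouplingRates`, crux
`ColdBoxTwoPointFloor` (stmt-QuantumFields-19456).
-/
import Summits.QuantumFields.YangMills.Theorems.WeakCouplingRates
import Literature.MathematicalPhysics.QuantumFieldTheory.LatticeMaxwellGaussian

/-!
# Route `WeakCouplingRates` — posited objects of the BOX split: the free comb-gauge lattice-Maxwell
# Gaussian of the cold box and its plaquette kernel `boxMaxwellPlaqCov` (definition D1)

The crux `Summit.QuantumFields.YangMills.Theses.WeakCouplingRates.ColdBoxTwoPointFloor` (BOX: in the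
cold-wall Wilson box of side `2⌈β^θ⌉+1`, `β² · Cov(c_{p_c}, c_{p_c + ⌈β^A⌉e₀}) ≥ c · C(⌈β^A⌉)²`) is split
by its registered birth skeleton (planner-ym-beyond-p3, `Lines-birth-ColdBoxTwoPointFloor.v2.lean`,
skeleton sha `0fd1e434…`) through ONE posited object, D1:

* `boxMaxwellPlaqCov H T` — the second moment `E_τ[s(p_c) s(p_c + T e₀)]` of the circulations
  (`LatticeMaxwell.sCirc`) of the free edge variables around the central `(1,2)`-plaquette
  `p_c = ((H,H,H,H); 1, 2)` of the vertex box `{0,…,2H}⁴` and around its translate by `T e₀`, under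
  Chatterjee's comb-gauge lattice Maxwell Gaussian `LatticeMaxwell.τ IsComb 0 (2H+1)` (S. Chatterjee,
  *The leading term of the Yang–Mills free energy*, JFA 271 (2016), arXiv:1602.01222, §13: the centred
  Gaussian on `ℝ^{free edges}` with density `∝ exp(−½ Σ_{p ⊆ box} s(p)²)`, the comb tree `E⁰` pinned to
  `0`, free boundary condition) — the `β → ∞` Gaussian companion of the Yang–Mills box covariance
  `boxPlaqCov ρ β H T` of the leaf module.  The registered stubs are
  `stub_boxGaussianFloor` (S3: `c₀ · boxMaxwellPlaqCov(⌈β^θ⌉,⌈β^A⌉)² ≤ β² · boxPlaqCov`, Gaussian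
  domination) and `stub_boxProjKernelVsLattice` (S4: `c₁ · |C(⌈β^A⌉)| ≤ |boxMaxwellPlaqCov(⌈β^θ⌉,⌈β^A⌉)|`,
  finite box vs `ℤ⁴`).

This file types D1 over tree declarations only (`LatticeMaxwell.τ`, `LatticeMaxwell.glue`,
`LatticeMaxwell.sCirc`, `AxialGauge.IsComb`, `boxCentre`), exactly as described in the route thesis
(`Theses/WeakCouplingRates.lean`, "D1 `boxMaxwellPlaqCov H T` = second moment of the (1,2)-plaquette
circulations `LatticeMaxwell.sCirc` at the box centre and its e₀-translate by T under Chatterjee's free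
comb-gauge Gaussian `LatticeMaxwell.τ AxialGauge.IsComb 0 (2H+1)`"), together with the vocabulary the
stub proofs share:

* `plaq12At x` — the plaquette label `(x; 1, 2) : Plaq 4`;
* `BoxFree H` — the free (non-comb) edges of the vertex box, the index type of the Gaussian;
* `boxMaxwell H` — the Gaussian `LatticeMaxwell.τ IsComb 0 (2H+1)` itself (an abbreviation);
* `boxCirc H p` — the circulation observable `s ↦ s(p)` (the Gaussian surrogate of one colour
  component of the `√(2β)`-rescaled plaquette field strength);
* `boxCircSqCov H T` — the connected two-point function `Cov_τ(s(p_c)², s(p_c + T e₀)²)` of the SQUARED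
  circulations (the Gaussian surrogate, per colour component and up to the factor `¼`, of
  `β² · boxPlaqCov`: for `SU(2)`, `β(2 − Re tr U_p) ≈ ½ Σ_{c=1}^{3} t^c(p)²` with three asymptotically
  independent copies `t^c` of the field of `boxMaxwell`, so `β² Cov(c₁,c₂) ≈ ¾ · boxCircSqCov`).

Design notes.  (1) NORMALISATION: `boxMaxwell` has density `∝ exp(−½ Σ s(p)²)` (Chatterjee's `τ`), the
same as the `ℤ⁴` curvature field behind `curvaturePlaquetteCorr` (so S4 holds with `c₁ → 1⁻` numerically:
kit j244532, cold-wall/`C∞` ≥ 0.9885 at `T ≤ H/2 ≤ 4`); all constants of S3/S4 are existential, so only the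
SHAPE of D1 matters.  (2) FREE vs DIRICHLET: the cold-wall Yang–Mills box (`boxState`: boundary links frozen
to `1`, boundary-straddling plaquettes counted) linearises to the DIRICHLET Maxwell Gaussian, not to the
free-boundary `τ`; by the thesis the free kernel is D1 and the Dirichlet-vs-free comparison at depth
`T = ⌈β^A⌉ ≪ H = ⌈β^θ⌉` is part of S3.  (3) The registered skeleton file is gate-host evidence not readable
from the fleet jail that wrote this file; should its D1 differ from this one in spelling (e.g. `pinI` for
`IsComb`, coercions), this module is the proposal of record and the skeleton is to import it.
No theorem of substance here: two `rfl` lemmas only.  NOT a claim about the mass gap.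
-/

set_option autoImplicit false

noncomputable section

open MeasureTheory
open Literature.MathematicalPhysics.QuantumFieldTheory
open Literature.MathematicalPhysics.QuantumFieldTheory.LatticeMaxwell
open Literature.MathematicalPhysics.QuantumFieldTheory.AxialGauge

namespace Summit.QuantumFields.YangMills.Theorems.WeakCouplingRates

/-- The `(1,2)`-plaquette label `(x; 1, 2) : Plaq 4` based at the site `x ∈ ℤ⁴` (the plaquette whose
Wilson cost `plaqCostAt ρ x 1 2` enters `boxPlaqCov`). -/
def plaq12At (x : Literature.Probability.LatticeModels.Site 4) : Plaq 4 := (x, 1, 2)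

/-- The free (non-comb) positively oriented edges of the vertex box `{0,…,2H}⁴`
(`LatticeMaxwell.Free IsComb 0 (2H+1)`, Chatterjee's `E¹_{2H+1}`) — the index type of the comb-gauge
lattice Maxwell Gaussian of the box. -/
abbrev BoxFree (H : ℕ) : Type :=
  LatticeMaxwell.Free (AxialGauge.IsComb (d := 4)) (0 : Literature.Probability.LatticeModels.Site 4)
    (2 * H + 1)

/-- The comb-gauge lattice Maxwell Gaussian `τ_{E⁰, 0, 2H+1}` of the vertex box `{0,…,2H}⁴`
(Chatterjee arXiv:1602.01222 §13; the tree's `LatticeMaxwell.τ IsComb 0 (2H+1) =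
multivariateGaussian 0 Q⁻¹`, `Q` the precision matrix `LatticeMaxwell.Qmat` of the form
`Σ_{p ⊆ box} s(p)²`). -/
abbrev boxMaxwell (H : ℕ) : Measure (EuclideanSpace ℝ (BoxFree H)) :=
  LatticeMaxwell.τ (AxialGauge.IsComb (d := 4)) (0 : Literature.Probability.LatticeModels.Site 4)
    (2 * H + 1)

/-- The circulation `s(p)` around the plaquette `p` of the free edge variables `s ∈ ℝ^{BoxFree H}`, glued
with the value `0` on the comb tree and off the box (`LatticeMaxwell.glue … 0 s`, `LatticeMaxwell.sCirc`):
the Gaussian surrogate of one colour component of the `√(2β)`-rescaled plaquette field strength. -/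
def boxCirc (H : ℕ) (p : Plaq 4) (s : EuclideanSpace ℝ (BoxFree H)) : ℝ :=
  sCirc (glue (pin := IsComb) (0 : Literature.Probability.LatticeModels.Site 4) (2 * H + 1) 0
    (WithLp.ofLp s)) p

/-- **D1 — the free comb-gauge lattice-Maxwell plaquette kernel of the box.**
`boxMaxwellPlaqCov H T = E_τ[s(p_c) · s(p_c + T e₀)]`, `τ = LatticeMaxwell.τ IsComb 0 (2H+1)`,
`p_c = ((H,H,H,H); 1, 2)` the central `(1,2)`-plaquette of the vertex box `{0,…,2H}⁴` (`boxCentre H` of the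
leaf module) and `p_c + T e₀` its translate in the `e₀` direction: the second moment (= covariance, `τ`
being centred) of the two circulations.  Written over `LatticeMaxwell.sCirc`/`glue`/`τ` and
`AxialGauge.IsComb` as in the route thesis (planner-ym-beyond-p3, BOX birth skeleton, definition D1). -/
def boxMaxwellPlaqCov (H T : ℕ) : ℝ :=
  ∫ s, sCirc (glue (pin := IsComb) (0 : Literature.Probability.LatticeModels.Site 4) (2 * H + 1) 0
          (WithLp.ofLp s)) (plaq12At (boxCentre H)) *
        sCirc (glue (pin := IsComb) (0 : Literature.Probability.LatticeModels.Site 4) (2 * H + 1) 0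
          (WithLp.ofLp s)) (plaq12At (boxCentre H + Pi.single 0 (T : ℤ)))
    ∂(LatticeMaxwell.τ IsComb (0 : Literature.Probability.LatticeModels.Site 4) (2 * H + 1))

/-- **The connected two-point function of the SQUARED circulations** of the two plaquettes of D1:
`boxCircSqCov H T = E_τ[s(p_c)² s(p_c+Te₀)²] − E_τ[s(p_c)²] · E_τ[s(p_c+Te₀)²]` — the Gaussian surrogate
(per colour component, up to the factor `¼`) of `β² · boxPlaqCov ρ β H T`; by Wick's theorem it equals
`2 · boxMaxwellPlaqCov H T ²` (proved in the stub file, not here). -/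
def boxCircSqCov (H T : ℕ) : ℝ :=
  (∫ s, boxCirc H (plaq12At (boxCentre H)) s ^ 2 *
      boxCirc H (plaq12At (boxCentre H + Pi.single 0 (T : ℤ))) s ^ 2 ∂(boxMaxwell H)) -
    (∫ s, boxCirc H (plaq12At (boxCentre H)) s ^ 2 ∂(boxMaxwell H)) *
      (∫ s, boxCirc H (plaq12At (boxCentre H + Pi.single 0 (T : ℤ))) s ^ 2 ∂(boxMaxwell H))

/-- D1 in the shared vocabulary: `boxMaxwellPlaqCov H T = ∫ boxCirc(p_c) · boxCirc(p_c + T e₀) d(boxMaxwell H)`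
(definitional unfolding). -/
theorem boxMaxwellPlaqCov_eq_integral_boxCirc (H T : ℕ) :
    boxMaxwellPlaqCov H T = ∫ s, boxCirc H (plaq12At (boxCentre H)) s *
      boxCirc H (plaq12At (boxCentre H + Pi.single 0 (T : ℤ))) s ∂(boxMaxwell H) := rfl

/-- `boxCirc` unfolded (definitional). -/
theorem boxCirc_apply (H : ℕ) (p : Plaq 4) (s : EuclideanSpace ℝ (BoxFree H)) :
    boxCirc H p s = sCirc (glue (pin := IsComb) (0 : Literature.Probability.LatticeModels.Site 4)
      (2 * H + 1) 0 (WithLp.ofLp s)) p := rfl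

/-! ## D1' — the temporal-gauge DIRICHLET lattice Maxwell Gaussian of the cold-wall box (appended 2026-08-26)

The cold-wall Yang–Mills box state `boxState ρ β H` (boundary links frozen to `1`, every plaquette TOUCHING the box
counted) linearises, as `β → ∞`, to the DIRICHLET Maxwell Gaussian below — not to the free-boundary `boxMaxwell H` of
D1.  It is typed, like D1, over Chatterjee's `LatticeMaxwell.τ`/`glue`/`sCirc`, on the ENLARGED vertex box
`{−1,…,2H+1}⁴` (corner `dirCorner`, side `2H+3`: one collar layer, so that the plaquettes of the enlarged box are exactly
the plaquettes touching the cold box plus plaquettes all of whose edges are pinned), with every edge off the cold box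
pinned to `0` (the cold wall) and, inside, the TEMPORAL GAUGE FOREST `{(x, e₀) : x interior}` pinned to `0` (a maximal
gauge tree of the cold-wall box: boundary vertices are identified through the frozen outside; each interior vertex is
joined to the top face by its temporal line).  The precision matrix of this Gaussian is positive definite (the cold wall
and the forest leave no flat direction) — proved in `Theorems/WeakCouplingRatesColdBoxDirichletPosDef.lean`; here only
the objects.  Consumers: piece S3c-ii/S3c-iii of stub `stub_boxGaussianDomination` (YM box ↔ Dirichlet Gaussian ↔ free
kernel), BULK's `stub_goodBoundaryCovStable` (unique classical background for Dirichlet data), ThermalRuler F2. -/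

/-- The corner `(−1,−1,−1,−1)` of the enlarged vertex box `{−1,…,2H+1}⁴` (one collar layer around the cold box
`{0,…,2H}⁴`). -/
def dirCorner : Literature.Probability.LatticeModels.Site 4 := fun _ => -1

/-- The opposite corner `(2H+1,…,2H+1)` of the enlarged vertex box. -/
def dirTop (H : ℕ) : Literature.Probability.LatticeModels.Site 4 := fun _ => 2 * (H : ℤ) + 1

/-- **The free edges of the Dirichlet problem**: the edges of the cold box `Λ = boxEdges 4 (2H+1)` that are NOT on
the temporal gauge forest `{(x, e₀) : x interior}` (interior = all coordinates in `[1, 2H−1]`).  Every other edge of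
`ℤ⁴` is pinned to `0`: outside `Λ` this is the cold wall, on the forest it is the temporal gauge. -/
def dirFreeEdges (H : ℕ) : Finset (Literature.MathematicalPhysics.QuantumLattice.ZdEdge 4) :=
  (boxEdges 4 (2 * H + 1)).filter fun e => ¬ (e.2 = 0 ∧ ∀ k : Fin 4, 1 ≤ e.1 k ∧ e.1 k + 1 ≤ 2 * H)

/-- Membership in `dirFreeEdges`. -/
theorem mem_dirFreeEdges {H : ℕ} {e : Literature.MathematicalPhysics.QuantumLattice.ZdEdge 4} :
    e ∈ dirFreeEdges H ↔
      e ∈ boxEdges 4 (2 * H + 1) ∧ ¬ (e.2 = 0 ∧ ∀ k : Fin 4, 1 ≤ e.1 k ∧ e.1 k + 1 ≤ 2 * H) := by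
  simp [dirFreeEdges]

/-- The free edge variables of the Dirichlet problem, as Chatterjee's `LatticeMaxwell.Free` on the enlarged box with
pinned predicate «not a free edge» (decidable by unfolding: finset membership). -/
abbrev DirFree (H : ℕ) : Type :=
  LatticeMaxwell.Free (fun e => e ∉ dirFreeEdges H) dirCorner (2 * H + 3)

/-- **D1' — the temporal-gauge Dirichlet lattice Maxwell Gaussian of the cold-wall box** `{0,…,2H}⁴`: the centred
Gaussian `LatticeMaxwell.τ (· ∉ dirFreeEdges H) dirCorner (2H+3) = N(0, Q_D⁻¹)` on `ℝ^{DirFree H}`, density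
`∝ exp(−½ Σ_{p touching Λ} s(p)²)` with pinned/outside edges `0` — the `β → ∞` linearisation of `boxState ρ β H` in the
temporal gauge (one colour component, field rescaled by `√(2β)`).  `Q_D` is positive definite
(`posDef_dirQmat`, sibling file). -/
abbrev boxDirichlet (H : ℕ) : Measure (EuclideanSpace ℝ (DirFree H)) :=
  LatticeMaxwell.τ (fun e => e ∉ dirFreeEdges H) dirCorner (2 * H + 3)

/-- The glued edge function of Dirichlet free variables `s` (pinned and outside edges carry `0`). -/
abbrev dirGlue (H : ℕ) (s : DirFree H → ℝ) : Literature.MathematicalPhysics.QuantumLattice.ZdEdge 4 → ℝ :=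
  glue (pin := fun e => e ∉ dirFreeEdges H) dirCorner (2 * H + 3) 0 s

/-- The circulation `s(p)` of the Dirichlet free edge variables around the plaquette `p`. -/
def dirCirc (H : ℕ) (p : Plaq 4) (s : EuclideanSpace ℝ (DirFree H)) : ℝ :=
  sCirc (dirGlue H (WithLp.ofLp s)) p

/-- **The Dirichlet plaquette kernel** `Π^D_H(T) = E[s(p_c) · s(p_c + T e₀)]` under `boxDirichlet H` (the cold-wall
companion of D1 `boxMaxwellPlaqCov H T`; both tend to `curvaturePlaquetteCorr 4 T` as `T/H → 0`, numerics kit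
j244532). -/
def boxDirichletPlaqCov (H T : ℕ) : ℝ :=
  ∫ s, dirCirc H (plaq12At (boxCentre H)) s * dirCirc H (plaq12At (boxCentre H + Pi.single 0 (T : ℤ))) s
    ∂(boxDirichlet H)

/-- `dirCirc` unfolded (definitional). -/
theorem dirCirc_apply (H : ℕ) (p : Plaq 4) (s : EuclideanSpace ℝ (DirFree H)) :
    dirCirc H p s = sCirc (dirGlue H (WithLp.ofLp s)) p := rfl

/-- **The connected two-point function of the SQUARED Dirichlet circulations** of the two plaquettes of D1/D1':
`boxDirCircSqCov H T = E_D[s(p_c)² s(p_c+Te₀)²] − E_D[s(p_c)²]·E_D[s(p_c+Te₀)²]` under `boxDirichlet H` — the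
Gaussian surrogate (per colour component, up to the factor `¼`) of `β² · boxPlaqCov ρ β H T` in the cold-wall box's
OWN linearisation; equals `2 · boxDirichletPlaqCov H T ²` by Wick (`dirCirc_sq_cov_eq`, file
`…ColdBoxDirichletWick`).  (Appended 2026-08-26 for the v5 cut S3 ⇐ S3c-ii ∧ S3c-iii of the birth skeleton.) -/
def boxDirCircSqCov (H T : ℕ) : ℝ :=
  (∫ s, dirCirc H (plaq12At (boxCentre H)) s ^ 2 *
      dirCirc H (plaq12At (boxCentre H + Pi.single 0 (T : ℤ))) s ^ 2 ∂(boxDirichlet H)) -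
    (∫ s, dirCirc H (plaq12At (boxCentre H)) s ^ 2 ∂(boxDirichlet H)) *
      (∫ s, dirCirc H (plaq12At (boxCentre H + Pi.single 0 (T : ℤ))) s ^ 2 ∂(boxDirichlet H))

/-! ## S4 objects — the box projection kernel, the Green 2-tensor of a plaquette, the ramp cut-off (appended 2026-08-26)

Objects of stub S4 `stub_boxProjKernelVsLattice` of crux `ColdBoxTwoPointFloorW` (stmt-QuantumFields-19608, skeleton v5; fleet
seat `ym-wcr-19608-p2`): the comparison `|boxMaxwellPlaqCov H T − curvaturePlaquetteCorr 4 T| = O(H⁻⁴)` (`T ≤ H/8`) is proved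
by writing the box kernel as an orthogonal PROJECTION kernel (`boxProjKernel`, algebra in `Theorems/WeakCouplingRatesBoxProjection.lean`),
splitting the point mass `δ_q` on `ℤ⁴` by the lattice Hodge identity applied to the Green 2-tensor `greenTensor q`, and cutting
the co-exact part off inside the box with the ramp `boxCutoff H`.  Definitions only; the theorems are in the S4 proof files. -/


/-- **The projection kernel of the box** (S4 vocabulary): `boxProjKernel H p q = λ_p · Q⁻¹ λ_q`, the bilinear form of
the inverse comb-gauge precision matrix `Q = LatticeMaxwell.Qmat IsComb 0 (2H+1)` on the circulation coefficient
vectors `λ = LatticeMaxwell.coeff IsComb 0 (2H+1)` of two plaquettes; by `integral_boxCirc_mul_boxCirc` it is the second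
moment `E_τ[s(p)s(q)]` of the free box Gaussian `boxMaxwell H`, and `boxMaxwellPlaqCov H T = boxProjKernel H p_c (p_c + Te₀)`
(`boxMaxwellPlaqCov_eq_dotProduct`).  As a kernel on the plaquettes of the box it is the orthogonal projection of
`ℝ^{plaquettes}` onto the curls of comb-gauge edge functions. -/
def boxProjKernel (H : ℕ) (p q : Plaq 4) : ℝ :=
  dotProduct (coeff IsComb (0 : Literature.Probability.LatticeModels.Site 4) (2 * H + 1) p)
    ((Qmat (AxialGauge.IsComb (d := 4)) (0 : Literature.Probability.LatticeModels.Site 4) (2 * H + 1))⁻¹.mulVec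
      (coeff IsComb (0 : Literature.Probability.LatticeModels.Site 4) (2 * H + 1) q))

/-- **The Green 2-tensor of a plaquette** `q = (x; i, j)` of `ℤ^d`: `greenTensor q (y; k, l) = ½G(y − x)·ω_{ij}(k,l)`,
`G = latticeGreen` (so `½G` is the Green function of the graph Laplacian, `(-Δ)(½G) = δ₀` in `d ≥ 3`, tree
`latticeLaplacianZd_half_latticeGreen`) and `ω_{ij}` the elementary alternating tensor (`+1` at `(i,j)`, `−1` at
`(j,i)`).  It solves `−Δ g_q = δ_q` componentwise (`δ_q` = `plaqChain q`), so that the lattice Hodge identity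
`div₃ ∘ d₂ + d₁ ∘ div₂ = −Δ` (tree `LatticeChain.div₃_d₂_add_d₁_div₂`) splits the point mass at `q` into a curl
`d₁ (div₂ g_q)` — whose value at `p` is the `ℤ^d` curvature two-point kernel `curvatureTwoPoint p q` — and a
co-exact part `div₃ (d₂ g_q)` (S4 of crux `ColdBoxTwoPointFloorW`). -/
def greenTensor {d : ℕ} (q : Plaq d) : Literature.Probability.LatticeModels.Site d → Fin d → Fin d → ℝ :=
  fun y k l => Literature.Probability.LatticeModels.latticeGreen (y - q.1) / 2 *
    ((if k = q.2.1 ∧ l = q.2.2 then 1 else 0) - (if k = q.2.2 ∧ l = q.2.1 then 1 else 0))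

/-- **The ramp cut-off of the box** `{0,…,2H}⁴`: as a function of the sup-distance `r = ‖y − (H,H,H,H)‖∞` to the
centre, `1` for `r ≤ H/2 − 1`, `0` for `r ≥ H − 1`, linear of slope `2/H` in between.  Multiplying the co-potential
`d₂ (greenTensor q)` by it localises the co-exact part of `δ_q` inside the box at the price `O(H⁻⁴)` in `ℓ²`
(S4 of crux `ColdBoxTwoPointFloorW`). -/
def boxCutoff (H : ℕ) (y : Literature.Probability.LatticeModels.Site 4) : ℝ :=
  min 1 (max 0 (2 * ((H : ℝ) - 1 - ‖y - boxCentre H‖) / H))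


/-- **The projection kernel of the Dirichlet problem** (S3c-iii vocabulary, appended 2026-08-26): `boxDirProjKernel H p q = λ^D_p · Q_D⁻¹ λ^D_q`,
the bilinear form of the inverse precision matrix `Q_D = LatticeMaxwell.Qmat (· ∉ dirFreeEdges H) dirCorner (2H+3)` of the temporal-gauge
Dirichlet Gaussian `boxDirichlet H` (D1') on the circulation coefficient vectors of two plaquettes; by `integral_dirCirc_mul` it is
`E_D[s(p)s(q)]`, and `boxDirichletPlaqCov H T = boxDirProjKernel H p_c (p_c + Te₀)` (`boxDirichletPlaqCov_eq_dotProduct`).  As a kernel on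
the plaquettes of the enlarged box it is the orthogonal projection onto the curls of edge functions supported on the free Dirichlet edges
(equivalently, by the forest gauge, on the edges of the cold box). -/
def boxDirProjKernel (H : ℕ) (p q : Plaq 4) : ℝ :=
  dotProduct (coeff (fun e => e ∉ dirFreeEdges H) dirCorner (2 * H + 3) p)
    ((Qmat (fun e => e ∉ dirFreeEdges H) dirCorner (2 * H + 3))⁻¹.mulVec
      (coeff (fun e => e ∉ dirFreeEdges H) dirCorner (2 * H + 3) q))

end Summit.QuantumFields.YangMills.Theorems.WeakCouplingRates

end
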